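import Mathlib.Algebra.Module.Torsion.Basic
import Mathlib.LinearAlgebra.FreeModule.Basic
import Mathlib.Algebra.Polynomial.Module.Basic
import Mathlib.Algebra.BigOperators.Finprod
import Mathlib.GroupTheory.GroupAction.Quotient
import Mathlib.GroupTheory.GroupAction.CardCommute
import Mathlib.SetTheory.Cardinal.Finite
import HarnessLib

/-!
# Laumon–Ngô 2008, APPENDICE A — §A.1 «Localisation à la Atiyah–Borel–Segal», §A.2 «Cohomologie équivariante de la droite
# projective pincée», §A.3 «Une formule des points fixes»: the numbered statements (named facts ∕ algebraic cores, no proofs)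

[LaumonNgo2008] = G. Laumon, B. C. Ngô, *Le lemme fondamental pour les groupes unitaires*, Ann. of Math. (2) **168** (2008), 477–573,
Appendice A (Annals pp. 559–572).  SOURCE READ: the authors' TeX of arXiv `math/0404454` (`paper:arxiv-math_0404454`, chunks p0047–p0053 =
App. A.1–A.3; every quotation below is from those chunks); pins are «(App. A.n, arXiv math/0404454)» plus the Annals page range of the appendix
(the page-exact Annals print used by the ch. 1–3 files was not in this seat's store; lit3's CONCORDANCE-LN2008.md maps § ↔ page).  Squad TN carpet
(cell `pub/hodgecm-mathlib`, seat TN-t06, DEAL v3 ④); conventions = the companion files ★ `LaumonNgo2008.HitchinFibration` ∕ ★ `GeometricEndoscopy`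
∕ ★ `GeometricEndoscopyII` (TN-t05): every `def LaumonNgo2008_… : Prop` is a NAMED FACT (nothing asserted); **(core)** = the algebraic ∕
combinatorial statement the printed proof reduces the item to, typed on genuine Mathlib objects; items whose content is a statement about `ℓ`-adic
complexes ∕ perverse sheaves ∕ weights ∕ Chern classes ∕ algebraic stacks have no Mathlib notion and no set-level shadow and are **not typed** (one
census line each; never an axiom or a `True`-bodied def).  No `sorry`, no `axiom`, no `instance`, no `notation`; ED. 2 (paydown pass, same seat)
APPENDS the discharges `LaumonNgo2008_A_1_3_torsionToFreeCore_holds`, `LaumonNgo2008_A_2_5_imageCore_holds`, `LaumonNgo2008_A_3_2_ii_bijectionCore_holds`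
(+ the linearity lemmas `mulTAddC_add`, `mulTAddC_smul`); ED. 3 APPENDS `LaumonNgo2008_A_3_2_iii_resummationCore_holds` (+ the fibre count
`card_filter_quotientMk_eq`); ED. 4 APPENDS `LaumonNgo2008_A_3_1_countingCore_holds` (PROP A.3.1 counting core via Mathlib's class equation
`MulAction.card_eq_sum_card_group_div_card_stabilizer`, + `langMap_apply`, `mem_rationalPoints_iff`, `langMap_eq_one_iff`, `stabilizer_smul_comm`);
ED. 5 APPENDS `LaumonNgo2008_A_2_4_exactCore_holds` (COR A.2.4 short exactness: division by `t + c_S` in `D[t]`,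
`exists_mulTAddC_eq_sub`, and injectivity of `t + c_S` by top coefficients, `mulTAddC_injective`) — after ED. 5 EVERY named fact of this file is a theorem.
HONEST LABEL: HC_CM is proved only modulo the printed citations until rung 0 closes; this file pays nothing.

## Setting (App. A.1–A.3)

A.1: `S` a `k`-scheme of finite type, `f : X → S` proper with an action of a smooth commutative `S`-group scheme `P`, `T × Λ → P` (`T` an `S`-torus,
`Λ` a finitely generated abelian group), `g : Y = X^T → S` the fixed points, `i : Y ↪ X`, `j : U = X − Y ↪ X`, `f^T : [X/T] → S`; the `κ`-isotypic
decompositions of the perverse cohomology sheaves `ᵖℋⁿ(f_*ℚ_ℓ)`, … under `Λ` (through a finite quotient, «lemme d'homotopie» = ★ LEMME 3.2.3, cited by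
name in ★ `GeometricEndoscopy`); the graded sheaf of `ℚ_ℓ`-algebras `ℚ_ℓ[X*(T)(−1)] = ⊕_n Sym^n(X*(T) ⊗ ℚ_ℓ(−1))` (Chern–Weil); purity hypothesis on
`ᵖℋⁿ(f_*ℚ_ℓ)_{κ₀}`.  A.2: `Y` a `k`-scheme, `ℒ` invertible, `p : P = ℙ(ℒ ⊕ 𝒪_Y) → Y` with its sections `σ₀, σ_∞` and the `𝔾_m`-action by
homotheties, `t = c₁(𝒯)` the Chern class of the universal invertible module on `B(𝔾_{m,Y}/Y)`, `c = c₁(ℒ)`, `c_S = ⊕_n ᵖℋⁿ(g_*(c))`, `D = ⊕_n ᵖℋⁿ(g_*ℚ_ℓ)`,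
`D[t] = D ⊗ ℚ_ℓ[t]`; the `𝔾_{m,S}`-equivariant pinching `ρ : P → X` along `σ₀, σ_∞`, `i : Y ↪ X` with image `X^{𝔾_m}`, the automorphisms `ι₀, ι_∞`
of `Y`, the `ℤ^I`-actions and the two hypotheses on `ℓ`-adic cohomology (App. A.2).  A.3: `X` proper over `k = 𝔽_q` with an action of a smooth
commutative `k`-group scheme `G` of finite type with `π₀(G)` split; Lang's theorem `G⁰(k̄) = {ℒ_q(g) := Frob_q(g) g⁻¹}`; the groupoid `[X/G](k)` of
pairs `(x, g)`, `Frob_q(x) = g·x`, its isomorphism classes `[X/G](k)_♯`, `cl : [X/G](k)_♯ → π₀(G)(k)`, `Aut(x, g) = G_x(k)`.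

## How each numbered item is carried (COMPLETENESS CENSUS — 10 items)

| item (App. §; Annals pp. 559–572) | disposition |
|---|---|
| PROPOSITION A.1.1 (A.1) `⊕_n ᵖℋⁿ(f^T_*ℚ_ℓ)_{κ₀} ≅ (⊕_n ᵖℋⁿ(f_*ℚ_ℓ)_{κ₀}) ⊗ ℚ_ℓ[X*(T)(−1)]`, «en particulier … un module libre de type fini» | **not typed** (perverse cohomology of a quotient stack, purity, Chern–Weil). |
| PROPOSITION A.1.2 (A.1) `⊕_n ᵖℋⁿ(f^T_*[j]_!ℚ_ℓ)` is a TORSION `ℚ_ℓ[X*(T)(−1)]`-module | **not typed** (perverse sheaves; proof by a `T`-invariant stratification and a spectral sequence). |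
| COROLLAIRE A.1.3 (A.1) «la flèche `⊕ᵖℋⁿ(f^T_*[j]_!ℚ_ℓ)_{κ₀} → ⊕ᵖℋⁿ(f^T_*ℚ_ℓ)_{κ₀}` est nulle et la flèche de restriction … est injective» | `LaumonNgo2008_A_1_3_torsionToFreeCore` (core: «Une flèche d'un module de torsion dans un module libre sur `ℚ_ℓ[X*(T)(−1)]` est nécessairement nulle», typed for any commutative ring whose non-zero-divisors are the non-zero elements — a domain — as Mathlib `Module.IsTorsion` → `Module.Free` → `f = 0`); the sheaf statement itself **not typed**. |
| LEMME A.2.1 (A.2) `ℒ̃ = 𝒯 ⊗ ε_Y^* ℒ` on `B(𝔾_{m,Y}/Y)` | **not typed** (invertible modules on a classifying stack). |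
| PROPOSITION A.2.2 (A.2) `[p]_*ℚ_ℓ → ℚ_ℓ ⊕ ℚ_ℓ` ≅ `a ⊕ b ↦ (a + c̃(b)) ⊕ (a − c̃(b))`, `c̃ = t + ε_Y^*(c)` | **not typed** (ℓ-adic complexes on a stack, Chern classes); its algebraic shape is the degree-`≤ 1` part of `alphaMap` below. |
| COROLLAIRE A.2.3 (A.2) the restriction `ε_{Y,*}[p]_*ℚ_ℓ → ε_{Y,*}ℚ_ℓ ⊕ ε_{Y,*}ℚ_ℓ` ≅ `⊕_n(a_n ⊕ b_n) ↦ ⊕_n((a_n + b_n + c_{n+1}(b_{n+1})) ⊕ (a_n − b_n − c_{n+1}(b_{n+1})))` | **not typed** (ℓ-adic complexes); algebraic shape = `alphaMap`. |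
| COROLLAIRE A.2.4 (A.2) the triangle `g_*A → g_*B → g_*C →` gives a SHORT EXACT sequence `0 → ⊕ᵖℋⁿ(B) → ⊕ᵖℋⁿ(C) → ⊕ᵖℋ^{n+1}(A) → 0`, «canoniquement isomorphe à la suite exacte `0 → D[t] ⊕ tD[t] →^α D[t] ⊕ D[t] →^β D → 0`» with the printed `α`, `β` | `alphaMap`, `betaMap`, `evalNeg`, `mulTAddC` (the printed maps as genuine definitions on Mathlib `PolynomialModule`), `LaumonNgo2008_A_2_4_exactCore` (core: the printed sequence `(α, β)` IS short exact, for any module `D` over a commutative ring with `2` invertible and any endomorphism `c_S`); the identification with the perverse sequence **not typed**. |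
| PROPOSITION A.2.5 (A.2) for `κ(e₀) ≠ κ(e_∞)`, `i^*` is injective on the `κ`-part with image `(t + c_S)·(⊕ᵖℋ^m(g_*ℚ_ℓ)_κ)[t]` | `LaumonNgo2008_A_2_5_imageCore` (core = the proof's last line: «`{d(t) ∈ D[t] ∣ κ(e₀)d(t) − κ(e_∞)d(t) ∈ (t + c_S)D[t]} = (t + c_S)D[t]`» for `κ(e₀) ≠ κ(e_∞)` in `{±1}`); the injectivity∕image statement on perverse sheaves **not typed**. |
| PROPOSITION A.3.1 (A.3) fixed-point formula `Σ_n (−1)ⁿ Tr(Frob_q, Hⁿ(X_{k̄}, ℚ_ℓ)_χ) = |G⁰(k)| Σ_{(x,g) ∈ [X/G](k)_♯} χ(cl(x,g)) ∕ |Aut(x,g)|` | `LaumonNgo2008_A_3_1_countingCore` (core = the displayed claim of the proof: «`|X^{Frob_q ∘ γ̇⁻¹}| = Σ_{(x,g) ∈ [X/G](k)_♯, cl(x,g) = γ} |G(k)| ∕ |G_x(k)|`», over the unbundled point-level data `G(k̄)` acting on `X(k̄)` with Frobenius and the Lang map — `langMap`, `rationalPoints`, `neutralPoints`, `frobFixedBy`,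 `Obj`, `ObjIso`, `IsRepSystem`, `clObj`, `autCard`); the trace side **not typed** (ℓ-adic cohomology). |
| LEMME A.3.2 (A.3) (i) Deligne–Lusztig trace formula `Σ(−1)ⁿTr(…)_χ = |G(k)|⁻¹ Σ_{g ∈ G(k)} χ(g) |X^{Frob_q ∘ g⁻¹}|`; (ii) `g ↦ |X^{Frob_q ∘ g⁻¹}|` is constant on the connected components; (iii) non-vanishing only if `χ` factors through `π₀(G)(k)`, and then `= |π₀(G)(k)|⁻¹ Σ_γ χ(γ̇)|X^{Frob_q ∘ γ̇⁻¹}|` | (i) **not typed** (ℓ-adic trace; [De-Lu]); (ii) `LaumonNgo2008_A_3_2_ii_bijectionCore` (core = the proof's bijection `X^{Frob_q ∘ g⁻¹} ≃ X^{Frob_q ∘ (ℒ_q(h) g)⁻¹}`, `x ↦ h·x`); (iii) `LaumonNgo2008_A_3_2_iii_resummationCore` (core: the re-summation of the right side of (i) over `π₀(G)(k) = G(k)/G⁰(k)` for `χ` trivial on `G⁰(k)` and `N` constant on `G⁰(k)`-cosets); the vanishing clause **not typed** (uses the homotopy lemma on `Hⁿ`). |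

DEDUP (2026-09-02): `rg 'cite: LaumonNgo2008'` = the four companion files (ch. 1–4); no appendix item there; Mathlib has the algebra used by the
cores (`Module.IsTorsion`, `Module.Free`, `PolynomialModule`, `MulAction`, `Nat.card`, `finsum`) and nothing of the sheaf theory.
-/

namespace Literature.NumberTheory.Automorphic.LaumonNgo2008.Appendix

universe u v

/-! ## A.1 Localisation à la Atiyah–Borel–Segal -/

/-- **COROLLAIRE A.1.3, the proof's algebraic core** (App. A.1, arXiv chunk p0049): «Une flèche d'un module de torsion dans un module libre sur
`ℚ_ℓ[X^*(T)(−1)]` est nécessairement nulle.»  (Then: «La nullité de la première flèche implique l'injectivité de la seconde d'après la suite exacte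
longue» — the sheaf-level corollary is not typed.)  TYPED for a commutative ring `R` that is a domain (as the polynomial `ℚ_ℓ`-algebra
`ℚ_ℓ[X^*(T)(−1)]` is, étale-locally on `S`), a torsion `R`-module `M` (Mathlib `Module.IsTorsion`: every element is killed by a non-zero-divisor)
and a free `R`-module `N`: every `R`-linear `M → N` is zero. [cite: LaumonNgo2008, COROLLAIRE A.1.3, proof (App. A.1; Annals pp. 559–572)] -/
def LaumonNgo2008_A_1_3_torsionToFreeCore : Prop :=
  ∀ (R : Type u) [CommRing R] [IsDomain R] (M N : Type v) [AddCommGroup M] [Module R M] [AddCommGroup N] [Module R N],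
    Module.IsTorsion R M → Module.Free R N → ∀ f : M →ₗ[R] N, f = 0

/-! ## A.2 Cohomologie équivariante de la droite projective pincée — the algebra of `D[t]` -/

section Pinched

variable {R : Type u} [CommRing R] {D : Type v} [AddCommGroup D] [Module R D]

/-- **`d(−c_S) = Σ_n (−c_S)ⁿ(d_n)`** (App. A.2, before COROLLAIRE A.2.4: «`d(c_S) = Σ_n c_Sⁿ(d_n)` pour tout `d(t) = Σ_n d_n tⁿ ∈ D[t]`»), the
evaluation of a polynomial with coefficients in `D` at the ENDOMORPHISM `−c_S` of `D` (`D = ⊕_n ᵖℋⁿ(g_*ℚ_{ℓ,Y})`, `c_S = ⊕_n ᵖℋⁿ(g_*(c))` induced by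
`c = c₁(ℒ)`; here `D` is any `R`-module and `c` any `R`-linear endomorphism, `D[t]` = Mathlib `PolynomialModule R D`).
[cite: LaumonNgo2008, COROLLAIRE A.2.4 (App. A.2; Annals pp. 559–572)] -/
def evalNeg (c : D →ₗ[R] D) (d : PolynomialModule R D) : D :=
  d.coeff.sum fun n m => (((-c) ^ n : Module.End R D)) m

/-- **Multiplication by `t + c_S` on `D[t]`**: «`c_S d(t) = Σ_n c_S(d_n) tⁿ`» and `t` the variable, so `((t + c_S) d)(t) = t·d(t) + Σ_n c_S(d_n) tⁿ`
(App. A.2, COROLLAIRE A.2.4 and PROPOSITION A.2.5: the submodule `(t + c_S) D[t]`). [cite: LaumonNgo2008, COROLLAIRE A.2.4 (App. A.2; Annals pp. 559–572)] -/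
noncomputable def mulTAddC (c : D →ₗ[R] D) (d : PolynomialModule R D) : PolynomialModule R D :=
  (Polynomial.X : Polynomial R) • d + PolynomialModule.map R c d

/-- **The map `α` of COROLLAIRE A.2.4** (App. A.2): «`α : d₀(t) ⊕ t d₁(t) ↦ (d₀(t) + (t + c_S) d₁(t)) ⊕ (d₀(t) − (t + c_S) d₁(t))`» on
`D[t] ⊕ tD[t] → D[t] ⊕ D[t]`; typed on the pair `(d₀, d₁)` (the second summand `tD[t]` being parametrised by `d₁ ↦ t d₁`).
[cite: LaumonNgo2008, COROLLAIRE A.2.4 (App. A.2; Annals pp. 559–572)] -/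
noncomputable def alphaMap (c : D →ₗ[R] D) (d : PolynomialModule R D × PolynomialModule R D) :
    PolynomialModule R D × PolynomialModule R D :=
  (d.1 + mulTAddC c d.2, d.1 - mulTAddC c d.2)

/-- **The map `β` of COROLLAIRE A.2.4** (App. A.2): «`β : d₀(t) ⊕ d_∞(t) ↦ d₀(−c_S) − d_∞(−c_S)`» on `D[t] ⊕ D[t] → D`.
[cite: LaumonNgo2008, COROLLAIRE A.2.4 (App. A.2; Annals pp. 559–572)] -/
def betaMap (c : D →ₗ[R] D) (d : PolynomialModule R D × PolynomialModule R D) : D :=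
  evalNeg c d.1 - evalNeg c d.2

end Pinched

/-- **COROLLAIRE A.2.4, algebraic core** (App. A.2): the printed sequence «`0 → D[t] ⊕ tD[t] →^α D[t] ⊕ D[t] →^β D → 0`» with the printed `α`,
`β` (`alphaMap`, `betaMap`) IS SHORT EXACT — `α` injective, `image α = kernel β`, `β` surjective — for every module `D` over a commutative ring `R`
in which `2` is invertible (print: `ℚ_ℓ`-sheaves) and every `R`-linear `c_S : D → D`.  (The printed corollary asserts moreover that the perverse
cohomology sequence of the triangle `g_*A → g_*B → g_*C →` is canonically isomorphic to it — not typed.)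
[cite: LaumonNgo2008, COROLLAIRE A.2.4 (App. A.2; Annals pp. 559–572)] -/
def LaumonNgo2008_A_2_4_exactCore : Prop :=
  ∀ (R : Type u) [CommRing R] (D : Type v) [AddCommGroup D] [Module R D] (c : D →ₗ[R] D), IsUnit (2 : R) →
    Function.Injective (alphaMap c) ∧ Function.Surjective (betaMap c) ∧
      ∀ d : PolynomialModule R D × PolynomialModule R D, betaMap c d = 0 ↔ d ∈ Set.range (alphaMap c)

/-- **PROPOSITION A.2.5, the proof's concluding algebraic core** (App. A.2, last display of the proof): with `u` acting on `D_κ[t]` by the scalars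
`κ(e₀)`, `κ(e_∞)` (values of a character of `(ℤ/2ℤ)^I`, so in `{±1}`) and `κ(e₀) ≠ κ(e_∞)`, «son image est l'image réciproque par `u` de l'image
de `α`, c'est-à-dire `{d(t) ∈ D[t] ∣ κ(e₀) d(t) − κ(e_∞) d(t) ∈ (t + c_S) D[t]} = (t + c_S) D[t]`».  TYPED for any `R` with `2` invertible, any
`R`-module `D` with endomorphism `c_S`, and `κ₀, κ_∞ ∈ {1, −1} ⊂ R` distinct: the set of `d ∈ D[t]` with `κ₀ • d − κ_∞ • d ∈ range (t + c_S)` equals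
`range (t + c_S)` (`mulTAddC`).  The injectivity∕image statement for `i^*` on `⊕ᵖℋⁿ(f^{𝔾_m}_*ℚ_{ℓ,X})_κ` is not typed.
[cite: LaumonNgo2008, PROPOSITION A.2.5, proof (App. A.2; Annals pp. 559–572)] -/
def LaumonNgo2008_A_2_5_imageCore : Prop :=
  ∀ (R : Type u) [CommRing R] (D : Type v) [AddCommGroup D] [Module R D] (c : D →ₗ[R] D) (κ₀ κinf : R), IsUnit (2 : R) →
    (κ₀ = 1 ∨ κ₀ = -1) → (κinf = 1 ∨ κinf = -1) → κ₀ ≠ κinf →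
      {d : PolynomialModule R D | κ₀ • d - κinf • d ∈ Set.range (mulTAddC c)} = Set.range (mulTAddC c)

/-! ## A.3 Une formule des points fixes — the counting cores over `G(k̄)` acting on `X(k̄)` -/

section FixedPoints

/-! ⟨CARRIER⟩ **Point-level data of App. A.3** (unbundled, no structure, no instance): `G` = `G(k̄)` (a COMMUTATIVE group: «`G` un `k`-schéma en
groupes commutatifs lisse de type fini», Mathlib `[CommGroup G]`), acting on `X` = `X(k̄)` (`[MulAction G X]`); `frobG : G →* G` = `Frob_q` on
`G(k̄)`, `frobX : X → X` = `Frob_q` on `X(k̄)`, with the compatibility `frobX (g • x) = frobG g • frobX x` as an explicit HYPOTHESIS of the cores.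
Derived, as in print: the Lang map `ℒ_q(g) = Frob_q(g) g⁻¹` (`langMap`, a homomorphism since `G` is commutative), `G(k) = G(k̄)^{Frob_q}`
(`rationalPoints`), `G⁰(k̄) := {ℒ_q(g)}` («Le théorème de Lang assure que `G⁰(k̄) = {ℒ_q(g) ∣ g ∈ G(k̄)}`» — taken here as the DEFINITION of the
point-level neutral component, `neutralPoints`), `π₀(G)(k) = π₀(G)(k̄) = G(k̄)/G⁰(k̄)` («déployé»), the fixed sets `X^{Frob_q ∘ g⁻¹}` (`frobFixedBy`),
the objects `(x, g)` of `[X/G](k)` (`Obj`), their isomorphism relation (`ObjIso`), systems of representatives `[X/G](k)_♯` (`IsRepSystem`), `cl`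
read on objects (`clObj`), and `|Aut(x, g)| = |G_x(k)|` (`autCard`). -/

variable {G X : Type u} [CommGroup G] [MulAction G X]

/-- The Lang map `ℒ_q(g) = Frob_q(g) g⁻¹`, as the homomorphism `Frob_q · id⁻¹` of the commutative group `G(k̄)` (App. A.3).
[cite: LaumonNgo2008, App. A.3 (Annals pp. 559–572)] -/
def langMap (frobG : G →* G) : G →* G := frobG * (MonoidHom.id G)⁻¹

/-- `G(k) = {g ∈ G(k̄) ∣ Frob_q(g) = g}`, the equaliser of `Frob_q` and the identity (App. A.3). [cite: LaumonNgo2008, App. A.3 (Annals pp. 559–572)] -/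
def rationalPoints (frobG : G →* G) : Subgroup G := frobG.eqLocus (MonoidHom.id G)

/-- `G⁰(k̄) = {ℒ_q(g) ∣ g ∈ G(k̄)}` — Lang's theorem, taken as the point-level definition of the neutral component: the range of `langMap` (App. A.3:
«Le théorème de Lang assure que `G⁰(k̄) = {ℒ_q(g) := Frob_q(g)g⁻¹ ∣ g ∈ G(k̄)}`»). [cite: LaumonNgo2008, App. A.3 (Annals pp. 559–572)] -/
def neutralPoints (frobG : G →* G) : Subgroup G := (langMap frobG).range

/-- `X^{Frob_q ∘ g⁻¹} = {x ∈ X(k̄) ∣ Frob_q(x) = g·x}` (LEMME A.3.2). [cite: LaumonNgo2008, LEMME A.3.2 (App. A.3; Annals pp. 559–572)] -/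
def frobFixedBy (frobX : X → X) (g : G) : Set X := {x | frobX x = g • x}

variable (G) in
/-- The objects of `[X/G](k)`: «les couples `(x, g) ∈ X(k̄) × G(k̄)` tels que `Frob_q(x) = g·x`» (App. A.3).
[cite: LaumonNgo2008, App. A.3 (Annals pp. 559–572)] -/
def Obj (frobX : X → X) : Type u := {p : X × G // frobX p.1 = p.2 • p.1}

/-- The isomorphism relation on the objects of `[X/G](k)`: «pour morphismes de `(x, g)` dans un autre objet `(x′, g′)` les `h ∈ G(k̄)` tels que
`h·x = x′` et que `ℒ_q(h) g = g′`» (App. A.3). [cite: LaumonNgo2008, App. A.3 (Annals pp. 559–572)] -/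
def ObjIso (frobG : G →* G) (frobX : X → X) (p p' : Obj G frobX) : Prop :=
  ∃ h : G, h • p.1.1 = p'.1.1 ∧ langMap frobG h * p.1.2 = p'.1.2

/-- «On note aussi `[X/G](k)_♯` un système de représentants de ces classes d'isomorphie» (App. A.3): `Rep ⊂ Obj` meets every isomorphism class
exactly once. [cite: LaumonNgo2008, App. A.3 (Annals pp. 559–572)] -/
def IsRepSystem (frobG : G →* G) (frobX : X → X) (Rep : Set (Obj G frobX)) : Prop :=
  ∀ p : Obj G frobX, ∃! r : Obj G frobX, r ∈ Rep ∧ ObjIso frobG frobX p r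

/-- `cl(x, g)` = «la composante connexe de `G` contenant `g`», read in `π₀(G)(k̄) = G(k̄)/G⁰(k̄)` (App. A.3; «bien définie car `ℒ_q(h) ∈ G⁰(k̄)`»).
[cite: LaumonNgo2008, App. A.3 (Annals pp. 559–572)] -/
def clObj (frobG : G →* G) (frobX : X → X) (p : Obj G frobX) : G ⧸ neutralPoints frobG := QuotientGroup.mk p.1.2

/-- `|Aut(x, g)| = |G_x(k)|`: «le groupe des automorphismes de l'objet `(x, g)` dans `[X/G](k)` est le groupe fini `Aut(x, g) = G_x(k)`» — the
stabiliser `G_x(k̄) ∩ G(k)`, through `Nat.card` (App. A.3). [cite: LaumonNgo2008, App. A.3 (Annals pp. 559–572)] -/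
noncomputable def autCard (frobG : G →* G) (frobX : X → X) (p : Obj G frobX) : ℕ :=
  Nat.card ↥(MulAction.stabilizer G p.1.1 ⊓ rationalPoints frobG)

end FixedPoints

/-- **PROPOSITION A.3.1, the counting core of its proof** (App. A.3, «Démonstration de proposition»): for `γ̇ ∈ G(k)` in the connected component
`γ ∈ π₀(G)(k)`, «il s'agit de montrer que `|X^{Frob_q ∘ γ̇⁻¹}| = Σ_{(x,g) ∈ [X/G](k)_♯, cl(x,g) = γ} |G(k)| ∕ |G_x(k)|`» (the map `φ_γ̇ : x ↦ [(x, γ̇)]`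
is onto `cl⁻¹(γ)` with fibres `≅ G(k)/G_x(k)`).  TYPED over the point-level data (`G(k̄)` commutative acting on `X(k̄)`, `Frob_q` on both,
compatible), with `G(k)` finite, a system of representatives `Rep = [X/G](k)_♯`, and the fixed set finite: `|G_x(k)|` divides `|G(k)|` for the
representatives over `γ`, and `|X^{Frob_q ∘ γ̇⁻¹}| = Σᶠ_{r ∈ Rep, cl r = γ} |G(k)| ∕ |Aut r|`.  The printed proposition (alternating Frobenius trace on
`Hⁿ(X_{k̄}, ℚ_ℓ)_χ` = `|G⁰(k)| Σ χ(cl(x,g)) ∕ |Aut(x,g)|`) is this core combined with LEMME A.3.2 (i)(iii); its cohomological side is not typed.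
[cite: LaumonNgo2008, PROPOSITION A.3.1, proof (App. A.3; Annals pp. 559–572)] -/
def LaumonNgo2008_A_3_1_countingCore : Prop :=
  ∀ (G X : Type u) [CommGroup G] [MulAction G X] (frobG : G →* G) (frobX : X → X),
    (∀ (g : G) (x : X), frobX (g • x) = frobG g • frobX x) →
    ∀ (Rep : Set (Obj G frobX)) (γ : G), IsRepSystem frobG frobX Rep → γ ∈ rationalPoints frobG → Finite ↥(rationalPoints frobG) →
      (frobFixedBy frobX γ).Finite →
      (∀ r : Obj G frobX, r ∈ Rep → clObj frobG frobX r = (QuotientGroup.mk γ : G ⧸ neutralPoints frobG) →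
          autCard frobG frobX r ∣ Nat.card ↥(rationalPoints frobG)) ∧
        Nat.card ↥(frobFixedBy frobX γ) =
          ∑ᶠ r : {r : Obj G frobX // r ∈ Rep ∧ clObj frobG frobX r = (QuotientGroup.mk γ : G ⧸ neutralPoints frobG)},
            Nat.card ↥(rationalPoints frobG) / autCard frobG frobX r.1

/-- **LEMME A.3.2 (ii), the proof's bijection (core)** (App. A.3): «pour chaque `h ∈ G(k̄)` …, on a une bijection
`X^{Frob_q ∘ g⁻¹} ⥲ X^{Frob_q ∘ (ℒ_q(h) g)⁻¹}`, `x ↦ h·x`» (so `g ↦ |X^{Frob_q ∘ g⁻¹}|` is constant on the `G⁰(k̄)`-cosets — «constante sur chacune des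
composantes connexes de `G`»).  TYPED: for `Frob`-compatible data and every `h, g ∈ G(k̄)`, `x ↦ h • x` maps `X^{Frob_q ∘ g⁻¹}` bijectively onto
`X^{Frob_q ∘ (ℒ_q(h) g)⁻¹}`. [cite: LaumonNgo2008, LEMME A.3.2 (ii) (App. A.3; Annals pp. 559–572)] -/
def LaumonNgo2008_A_3_2_ii_bijectionCore : Prop :=
  ∀ (G X : Type u) [CommGroup G] [MulAction G X] (frobG : G →* G) (frobX : X → X),
    (∀ (g : G) (x : X), frobX (g • x) = frobG g • frobX x) →
    ∀ h g : G, Set.BijOn (fun x : X => h • x) (frobFixedBy frobX g) (frobFixedBy frobX (langMap frobG h * g))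

/-- **LEMME A.3.2 (iii), the re-summation (core)** (App. A.3): if `χ : G(k) → K` factors through `G(k) ↠ π₀(G)(k) = G(k)/G⁰(k)` and
`N : G(k) → K` («`g ↦ |X^{Frob_q ∘ g⁻¹}|`») is constant on the `G⁰(k)`-cosets (part (ii)), then
«`|G(k)|⁻¹ Σ_{g ∈ G(k)} χ(g) N(g) = |π₀(G)(k)|⁻¹ Σ_{γ ∈ π₀(G)(k)} χ(γ̇) N(γ̇)`, où, pour chaque `γ`, `γ̇ ∈ G(k)` est n'importe quel élément de la
composante connexe `γ`» — TYPED for a finite commutative group `Gk` («`G(k)`»), a subgroup `G0 ≤ Gk` («`G⁰(k)`», so `π₀(G)(k) = Gk/G0` by the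
exact sequence `0 → G⁰(k) → G(k) → π₀(G)(k) → 0` of print), functions `χ N : Gk → K` into a field of characteristic zero that are the pull-backs
of `χbar Nbar` on the quotient (this IS «constant on cosets», and makes the choice of `γ̇` disappear).  The non-vanishing clause of (iii) («non
nulle seulement si `χ` se factorise», via the homotopy lemma on `Hⁿ`) and (i) (Deligne–Lusztig) are not typed.
[cite: LaumonNgo2008, LEMME A.3.2 (iii) (App. A.3; Annals pp. 559–572)] -/
def LaumonNgo2008_A_3_2_iii_resummationCore : Prop :=
  ∀ (Gk : Type u) [CommGroup Gk] [Fintype Gk] (G0 : Subgroup Gk) (K : Type v) [Field K] [CharZero K] (χ N : Gk → K)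
    (χbar Nbar : Gk ⧸ G0 → K), (∀ g : Gk, χ g = χbar (QuotientGroup.mk g)) → (∀ g : Gk, N g = Nbar (QuotientGroup.mk g)) →
      (Fintype.card Gk : K)⁻¹ * ∑ g : Gk, χ g * N g =
        (Nat.card (Gk ⧸ G0) : K)⁻¹ * ∑ᶠ γ : Gk ⧸ G0, χbar γ * Nbar γ

/-! ## Discharges (ED. 2, paydown pass): `_holds` theorems for three of the six cores — statements byte-unchanged -/

section Discharges

/-- **Discharge of `LaumonNgo2008_A_1_3_torsionToFreeCore`**: a free module over a domain has no zero smul-divisors (Mathlib instance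
`Module.Free.noZeroSMulDivisors`), so `a • f x = f (a • x) = 0` with `a ≠ 0` forces `f x = 0`. [cite: LaumonNgo2008, COROLLAIRE A.1.3, proof (App. A.1; Annals pp. 559–572)] -/
theorem LaumonNgo2008_A_1_3_torsionToFreeCore_holds : LaumonNgo2008_A_1_3_torsionToFreeCore := by
  intro R _ _ M N _ _ _ _ hM hN f
  haveI := hN
  ext x
  obtain ⟨a, ha⟩ := @hM x
  have ha' : (a : R) • x = 0 := ha
  have h : (a : R) • f x = 0 := by rw [← map_smul, ha', map_zero]
  rcases smul_eq_zero.mp h with h0 | h0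
  · exact absurd h0 (nonZeroDivisors.coe_ne_zero a)
  · simpa using h0

/-- **Discharge of `LaumonNgo2008_A_3_2_ii_bijectionCore`** — print's one-line proof: `x ↦ h·x` with inverse `x ↦ h⁻¹·x`, using
`Frob_q(h·x) = Frob_q(h)·Frob_q(x)` and the commutativity of `G(k̄)` (`ℒ_q(h) g · h = Frob_q(h) g`).
[cite: LaumonNgo2008, LEMME A.3.2 (ii), proof (App. A.3; Annals pp. 559–572)] -/
theorem LaumonNgo2008_A_3_2_ii_bijectionCore_holds : LaumonNgo2008_A_3_2_ii_bijectionCore := by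
  intro G X _ _ frobG frobX hfrob h g
  have hlang : langMap frobG h = frobG h * h⁻¹ := by
    simp [langMap, MonoidHom.mul_apply, MonoidHom.inv_apply]
  have key : ∀ x : X, x ∈ frobFixedBy frobX g ↔ h • x ∈ frobFixedBy frobX (langMap frobG h * g) := by
    intro x
    simp only [frobFixedBy, Set.mem_setOf_eq, hfrob, hlang]
    rw [show (frobG h * h⁻¹ * g) • h • x = frobG h • (g • x) by
      rw [← mul_smul, ← mul_smul, show frobG h * h⁻¹ * g * h = frobG h * g by
        rw [mul_assoc, mul_assoc, mul_comm g h, ← mul_assoc h⁻¹, inv_mul_cancel, one_mul]]]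
    constructor
    · intro hx; rw [hx]
    · intro hx; exact smul_left_cancel _ hx
  refine ⟨fun x hx => (key x).1 hx, fun x _ y _ hxy => smul_left_cancel h hxy, fun y hy => ?_⟩
  refine ⟨h⁻¹ • y, ?_, by simp⟩
  rw [key, smul_inv_smul]; exact hy

section MulTAddC

variable {R : Type u} [CommRing R] {D : Type v} [AddCommGroup D] [Module R D]

/-- `(t + c_S)·` is additive. [cite: LaumonNgo2008, COROLLAIRE A.2.4 (App. A.2; Annals pp. 559–572)] -/
theorem mulTAddC_add (c : D →ₗ[R] D) (d e : PolynomialModule R D) :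
    mulTAddC c (d + e) = mulTAddC c d + mulTAddC c e := by
  simp only [mulTAddC, smul_add, map_add]; abel

/-- `(t + c_S)·` is `R`-linear. [cite: LaumonNgo2008, COROLLAIRE A.2.4 (App. A.2; Annals pp. 559–572)] -/
theorem mulTAddC_smul (c : D →ₗ[R] D) (r : R) (d : PolynomialModule R D) :
    mulTAddC c (r • d) = r • mulTAddC c d := by
  simp only [mulTAddC, map_smul, smul_add]
  rw [smul_comm]

end MulTAddC

/-- **Discharge of `LaumonNgo2008_A_2_5_imageCore`** — `κ(e₀) − κ(e_∞) = ±2` is a unit and `(t + c_S)·` is `R`-linear, so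
`{d ∣ (κ(e₀) − κ(e_∞)) d ∈ (t + c_S)D[t]} = (t + c_S)D[t]` (the last line of the printed proof).
[cite: LaumonNgo2008, PROPOSITION A.2.5, proof (App. A.2; Annals pp. 559–572)] -/
theorem LaumonNgo2008_A_2_5_imageCore_holds : LaumonNgo2008_A_2_5_imageCore := by
  intro R _ D _ _ c κ₀ κinf h2 hκ₀ hκinf hne
  have hu : IsUnit (κ₀ - κinf) := by
    rcases hκ₀ with rfl | rfl <;> rcases hκinf with rfl | rfl
    · exact absurd rfl hne
    · have : (1 : R) - -1 = 2 := by ring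
      rw [this]; exact h2
    · have : (-1 : R) - 1 = -2 := by ring
      rw [this]; exact h2.neg
    · exact absurd rfl hne
  obtain ⟨u, hu'⟩ := hu
  ext d
  simp only [Set.mem_setOf_eq, Set.mem_range, ← sub_smul, ← hu']
  constructor
  · rintro ⟨e, he⟩
    refine ⟨((u⁻¹ : Rˣ) : R) • e, ?_⟩
    rw [mulTAddC_smul, he, smul_smul, Units.inv_mul, one_smul]
  · rintro ⟨e, rfl⟩
    exact ⟨(u : R) • e, by rw [mulTAddC_smul]⟩

end Discharges

/-! ## Discharges (ED. 3, paydown pass): LEMME A.3.2 (iii) re-summation — statement byte-unchanged -/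

section DischargesED3

/-- A fibre of `G(k) ↠ π₀(G)(k) = G(k)/G⁰(k)` has `|G⁰(k)|` elements: the fibre over `[g₀]` is the coset `g₀ G⁰(k)`, in bijection with `G⁰(k)` by
`g ↦ g₀⁻¹ g` (the counting step of LEMME A.3.2 (iii): «constante sur chacune des composantes connexes»).
[cite: LaumonNgo2008, LEMME A.3.2 (iii), proof (App. A.3; Annals pp. 559–572)] -/
theorem card_filter_quotientMk_eq {Gk : Type*} [CommGroup Gk] [Fintype Gk] (G0 : Subgroup Gk) [DecidableEq (Gk ⧸ G0)]
    (γ : Gk ⧸ G0) :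
    ((Finset.univ : Finset Gk).filter fun g => (QuotientGroup.mk g : Gk ⧸ G0) = γ).card = Nat.card G0 := by
  classical
  obtain ⟨g₀, rfl⟩ := QuotientGroup.mk_surjective γ
  rw [← Fintype.card_subtype, ← Nat.card_eq_fintype_card]
  refine Nat.card_congr
    { toFun := fun g => ⟨g₀⁻¹ * g.1, QuotientGroup.eq.mp g.2.symm⟩
      invFun := fun h => ⟨g₀ * h.1, ?_⟩
      left_inv := fun g => by simp
      right_inv := fun h => by simp }
  rw [QuotientGroup.eq]; simp

/-- **Discharge of `LaumonNgo2008_A_3_2_iii_resummationCore`** (LEMME A.3.2 (iii), the printed computation): summing `χ N = (χ̄ N̄) ∘ [·]`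
fibrewise over `G(k) ↠ G(k)/G⁰(k)` gives `Σ_g χ(g) N(g) = |G⁰(k)| Σ_γ χ̄(γ) N̄(γ)`, and `|G(k)| = |π₀(G)(k)| · |G⁰(k)|` (Lagrange,
`Subgroup.card_eq_card_quotient_mul_card_subgroup`) cancels `|G⁰(k)|` in characteristic zero.
[cite: LaumonNgo2008, LEMME A.3.2 (iii), proof (App. A.3; Annals pp. 559–572)] -/
theorem LaumonNgo2008_A_3_2_iii_resummationCore_holds : LaumonNgo2008_A_3_2_iii_resummationCore := by
  intro Gk _ _ G0 K _ _ χ N χbar Nbar hχ hN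
  classical
  have hfib : ∑ g : Gk, χ g * N g = ∑ γ : Gk ⧸ G0, (Nat.card G0 : K) * (χbar γ * Nbar γ) := by
    have h1 : ∑ g : Gk, χ g * N g
        = ∑ g : Gk, (fun γ : Gk ⧸ G0 => χbar γ * Nbar γ) (QuotientGroup.mk g) :=
      Finset.sum_congr rfl fun g _ => by simp only [hχ g, hN g]
    rw [h1, ← Finset.sum_fiberwise_of_maps_to (s := (Finset.univ : Finset Gk))
      (t := (Finset.univ : Finset (Gk ⧸ G0))) (g := fun g : Gk => (QuotientGroup.mk g : Gk ⧸ G0))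
      (fun _ _ => Finset.mem_univ _)]
    refine Finset.sum_congr rfl fun γ _ => ?_
    rw [Finset.sum_congr rfl (fun g hg => by rw [(Finset.mem_filter.mp hg).2]), Finset.sum_const, nsmul_eq_mul,
      card_filter_quotientMk_eq G0 γ]
  have hcard : (Fintype.card Gk : K) = (Nat.card (Gk ⧸ G0) : K) * (Nat.card G0 : K) := by
    rw [← Nat.card_eq_fintype_card, Subgroup.card_eq_card_quotient_mul_card_subgroup G0]; push_cast; ring
  have hG0 : (Nat.card G0 : K) ≠ 0 := Nat.cast_ne_zero.mpr Nat.card_pos.ne'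
  rw [hfib, ← Finset.mul_sum, ← mul_assoc, hcard, finsum_eq_sum_of_fintype, mul_inv,
    mul_assoc ((Nat.card (Gk ⧸ G0) : K)⁻¹), inv_mul_cancel₀ hG0, mul_one]

end DischargesED3

/-! ## Discharges (ED. 4, paydown pass): PROPOSITION A.3.1 counting core — statement byte-unchanged -/

section DischargesED4

variable {G X : Type u} [CommGroup G] [MulAction G X]

/-- Unfolding the Lang map: `ℒ_q(g) = Frob_q(g) g⁻¹`. [cite: LaumonNgo2008, App. A.3 (Annals pp. 559–572)] -/
theorem langMap_apply (frobG : G →* G) (g : G) : langMap frobG g = frobG g * g⁻¹ := rfl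

/-- Membership in `G(k)`: `Frob_q(g) = g`. [cite: LaumonNgo2008, App. A.3 (Annals pp. 559–572)] -/
theorem mem_rationalPoints_iff (frobG : G →* G) (g : G) : g ∈ rationalPoints frobG ↔ frobG g = g := Iff.rfl

/-- `ker ℒ_q = G(k)` («`0 → G(k) → G(k̄) →^{ℒ_q} G⁰(k̄) → 0`», App. A.3). [cite: LaumonNgo2008, App. A.3 (Annals pp. 559–572)] -/
theorem langMap_eq_one_iff (frobG : G →* G) (g : G) : langMap frobG g = 1 ↔ g ∈ rationalPoints frobG := by
  rw [langMap_apply, mul_inv_eq_one, mem_rationalPoints_iff]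

/-- For a COMMUTATIVE `G`, stabilisers are translation invariant: `G_{g·x} = G_x` (used in App. A.3: `Aut(x, g) = G_x(k)` depends only on
the isomorphism class). [cite: LaumonNgo2008, App. A.3 (Annals pp. 559–572)] -/
theorem stabilizer_smul_comm (g : G) (x : X) : MulAction.stabilizer G (g • x) = MulAction.stabilizer G x := by
  ext a
  rw [MulAction.mem_stabilizer_iff, MulAction.mem_stabilizer_iff, smul_smul, mul_comm, ← smul_smul,
    smul_left_cancel_iff]

open MulAction in
/-- **Discharge of `LaumonNgo2008_A_3_1_countingCore`** — the printed counting argument (App. A.3, «Démonstration de proposition»): `G(k)`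
acts on `X^{Frob_q ∘ γ̇⁻¹}` (a `SubMulAction`, by the compatibility `Frob(g·x) = Frob(g)·Frob(x)` and commutativity); the objects `(x, γ̇)`,
`x ∈ X^{Frob_q ∘ γ̇⁻¹}`, are isomorphic in `[X/G](k)` iff the points are `G(k)`-conjugate (`ker ℒ_q = G(k)`), every representative `r = (x_r, g_r)`
with `cl r = γ` is isomorphic to such an object through an `h_r` with `ℒ_q(h_r) = g_r⁻¹ γ̇` («`φ_γ̇` est surjective»), so `r ↦ G(k)·(h_r x_r)` is a
bijection from `{r ∈ [X/G](k)_♯ ∣ cl r = γ}` onto the `G(k)`-orbits («la fibre … s'identifie à `G(k)/G_x(k)`»), with `|Aut r| = |G_{x_r}(k)| =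
|G_{h_r x_r}(k)|` (`G` commutative); the class equation `|X^{Frob_q ∘ γ̇⁻¹}| = Σ_orbits |G(k)|∕|stabiliser|` is Mathlib's
`MulAction.card_eq_sum_card_group_div_card_stabilizer`, and `|G_x(k)| ∣ |G(k)|` is Lagrange. [cite: LaumonNgo2008, PROPOSITION A.3.1, proof (App. A.3; Annals pp. 559–572)] -/
theorem LaumonNgo2008_A_3_1_countingCore_holds : LaumonNgo2008_A_3_1_countingCore := by
  intro G X _ _ frobG frobX hcompat Rep γ hRep hγ hfinH hfinF
  classical
  refine ⟨fun r _ _ => Subgroup.card_dvd_of_le inf_le_right, ?_⟩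
  set H : Subgroup G := rationalPoints frobG with hHdef
  have memH : ∀ g : G, g ∈ H ↔ frobG g = g := fun g => Iff.rfl
  have langH : ∀ g : G, langMap frobG g = 1 ↔ g ∈ H := fun g => langMap_eq_one_iff frobG g
  -- the `G(k)`-stable subset `X^{Frob_q ∘ γ⁻¹}`
  let F : SubMulAction H X :=
    { carrier := frobFixedBy frobX γ
      smul_mem' := by
        intro h x hx
        change frobX ((h : G) • x) = γ • ((h : G) • x)
        rw [hcompat, (memH h).mp h.2, show frobX x = γ • x from hx, smul_smul, smul_smul, mul_comm] }
  have memF : ∀ x : X, x ∈ F ↔ frobX x = γ • x := fun x => Iff.rfl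
  haveI : Fintype H := Fintype.ofFinite H
  haveI : Finite F := hfinF.to_subtype
  haveI : Fintype F := Fintype.ofFinite F
  -- the index set of the printed sum, and a twist `h_r` with `ℒ_q(h_r) = g_r⁻¹ γ` for each index
  let I := {r : Obj G frobX // r ∈ Rep ∧ clObj frobG frobX r = (QuotientGroup.mk γ : G ⧸ neutralPoints frobG)}
  have hex : ∀ r : I, ∃ h : G, langMap frobG h = (r.1.1.2)⁻¹ * γ := by
    intro r
    have h2 : (QuotientGroup.mk r.1.1.2 : G ⧸ neutralPoints frobG) = QuotientGroup.mk γ := r.2.2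
    rw [QuotientGroup.eq] at h2
    obtain ⟨h, hh⟩ := h2
    exact ⟨h, hh⟩
  choose tw htw using hex
  have key : ∀ r : I, frobG (tw r) * r.1.1.2 = γ * tw r := by
    intro r
    have e := htw r
    rw [langMap_apply, mul_inv_eq_iff_eq_mul] at e
    rw [e]
    apply Additive.ofMul.injective
    simp only [ofMul_mul, ofMul_inv]
    abel
  have pt_mem : ∀ r : I, tw r • r.1.1.1 ∈ F := by
    intro r
    rw [memF, hcompat, r.1.2, smul_smul, smul_smul, key]
  let pt : I → F := fun r => ⟨tw r • r.1.1.1, pt_mem r⟩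
  let e₀ : I → Quotient (orbitRel H F) := fun r => Quotient.mk _ (pt r)
  -- isomorphic representatives are equal («système de représentants»)
  have huniq : ∀ r r' : I, ObjIso frobG frobX r.1 r'.1 → r = r' := by
    intro r r' hiso
    obtain ⟨r₀, -, hu⟩ := hRep r.1
    have e1 := hu r.1 ⟨r.2.1, ⟨1, by rw [one_smul], by rw [map_one, one_mul]⟩⟩
    have e2 := hu r'.1 ⟨r'.2.1, hiso⟩
    exact Subtype.ext (e1.trans e2.symm)
  -- `φ` is injective on classes: conjugate points give isomorphic, hence equal, representatives
  have hinj : Function.Injective e₀ := by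
    intro r r' hrr
    have hrel : (orbitRel H F) (pt r) (pt r') := Quotient.exact hrr
    rw [orbitRel_apply, mem_orbit_iff] at hrel
    obtain ⟨k, hk⟩ := hrel
    have hkX : ((k : G) * tw r') • r'.1.1.1 = tw r • r.1.1.1 := by
      rw [mul_smul]; exact congrArg Subtype.val hk
    apply huniq
    refine ⟨(tw r')⁻¹ * (k : G)⁻¹ * tw r, ?_, ?_⟩
    · rw [mul_smul, ← hkX, ← mul_inv_rev, inv_smul_smul]
    · have hk1 : langMap frobG (k : G) = 1 := (langH k).mpr k.2
      rw [map_mul, map_mul, map_inv, map_inv, htw, htw, hk1]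
      apply Additive.ofMul.injective
      simp only [ofMul_mul, ofMul_inv, ofMul_one]
      abel
  -- `φ_γ̇` is surjective: every `x ∈ X^{Frob_q ∘ γ⁻¹}` gives the object `(x, γ)`, represented by some `r` with `cl r = γ`
  have hsurj : Function.Surjective e₀ := by
    intro ω
    induction ω using Quotient.inductionOn with
    | h y =>
      let p : Obj G frobX := ⟨((y : X), γ), (memF y).mp y.2⟩
      obtain ⟨r, ⟨hrRep, m, hm1, hm2⟩, -⟩ := hRep p
      have hcl : clObj frobG frobX r = (QuotientGroup.mk γ : G ⧸ neutralPoints frobG) := by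
        change (QuotientGroup.mk r.1.2 : G ⧸ neutralPoints frobG) = QuotientGroup.mk γ
        rw [QuotientGroup.eq]
        refine ⟨m⁻¹, ?_⟩
        rw [map_inv, ← hm2]
        apply Additive.ofMul.injective
        simp only [ofMul_mul, ofMul_inv]
        abel
      let rI : I := ⟨r, hrRep, hcl⟩
      refine ⟨rI, Quotient.sound ?_⟩
      show (orbitRel H F) (pt rI) y
      rw [orbitRel_apply, mem_orbit_iff]
      have hkH : tw rI * m ∈ H := by
        rw [← langH, map_mul, htw]
        change (r.1.2)⁻¹ * γ * langMap frobG m = 1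
        rw [← hm2]
        apply Additive.ofMul.injective
        simp only [ofMul_mul, ofMul_inv, ofMul_one]
        abel
      refine ⟨⟨tw rI * m, hkH⟩, Subtype.ext ?_⟩
      change (tw rI * m) • (y : X) = tw rI • r.1.1
      rw [mul_smul, hm1]
  let e : I ≃ Quotient (orbitRel H F) := Equiv.ofBijective e₀ ⟨hinj, hsurj⟩
  haveI : Fintype I := Fintype.ofEquiv _ e.symm
  -- `|Aut| = |G_x(k)|`: the stabiliser in `G(k)` on `F` versus `G_x(k̄) ∩ G(k)` in `G(k̄)`
  have stab_card : ∀ y : F, Nat.card (stabilizer H y) = Nat.card ↥(stabilizer G (y : X) ⊓ H) := by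
    intro y
    refine Nat.card_congr
      { toFun := fun a => ⟨(a.1 : G), ?_, a.1.2⟩
        invFun := fun b => ⟨⟨b.1, (Subgroup.mem_inf.mp b.2).2⟩, ?_⟩
        left_inv := fun a => rfl
        right_inv := fun b => rfl }
    · have := congrArg Subtype.val (mem_stabilizer_iff.mp a.2)
      rw [SubMulAction.val_smul] at this
      exact mem_stabilizer_iff.mpr this
    · refine mem_stabilizer_iff.mpr (Subtype.ext ?_)
      rw [SubMulAction.val_smul, Subgroup.mk_smul]
      exact mem_stabilizer_iff.mp (Subgroup.mem_inf.mp b.2).1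
  have term_eq : ∀ r : I,
      Fintype.card H / Fintype.card (stabilizer H (e r).out) = Nat.card H / autCard frobG frobX r.1 := by
    intro r
    have hy : (orbitRel H F) (e r).out (pt r) := Quotient.exact (by
      rw [Quotient.out_eq]; rfl)
    rw [orbitRel_apply, mem_orbit_iff] at hy
    obtain ⟨k, hk⟩ := hy
    have hyX : ((e r).out : X) = ((k : G) * tw r) • r.1.1.1 := by
      rw [mul_smul, ← hk]; rfl
    rw [← Nat.card_eq_fintype_card, ← Nat.card_eq_fintype_card, stab_card, hyX, stabilizer_smul_comm]
    rfl
  have hcardF : Nat.card (frobFixedBy frobX γ) = Fintype.card F := by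
    rw [← Nat.card_eq_fintype_card]; rfl
  -- the class equation, re-indexed by the representatives
  rw [hcardF, MulAction.card_eq_sum_card_group_div_card_stabilizer H F, ← Equiv.sum_comp e,
    finsum_eq_sum_of_fintype]
  exact Finset.sum_congr rfl fun r _ => term_eq r

end DischargesED4

/-! ## Discharges (ED. 5, paydown pass): COROLLAIRE A.2.4 exactness core — statement byte-unchanged -/

section DischargesED5

open PolynomialModule

variable {R : Type u} [CommRing R] {D : Type v} [AddCommGroup D] [Module R D]

/-- `0(−c_S) = 0`. [cite: LaumonNgo2008, COROLLAIRE A.2.4 (App. A.2; Annals pp. 559–572)] -/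
theorem evalNeg_zero (c : D →ₗ[R] D) : evalNeg c 0 = 0 := by
  rw [evalNeg, coeff_zero, Finsupp.sum_zero_index]

/-- `d ↦ d(−c_S)` is additive. [cite: LaumonNgo2008, COROLLAIRE A.2.4 (App. A.2; Annals pp. 559–572)] -/
theorem evalNeg_add (c : D →ₗ[R] D) (d e : PolynomialModule R D) :
    evalNeg c (d + e) = evalNeg c d + evalNeg c e := by
  rw [evalNeg, evalNeg, evalNeg, coeff_add]
  exact Finsupp.sum_add_index' (fun n => map_zero _) (fun n a b => map_add _ a b)

/-- `(−d)(−c_S) = −d(−c_S)`. [cite: LaumonNgo2008, COROLLAIRE A.2.4 (App. A.2; Annals pp. 559–572)] -/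
theorem evalNeg_neg (c : D →ₗ[R] D) (d : PolynomialModule R D) : evalNeg c (-d) = -evalNeg c d := by
  have h := evalNeg_add c d (-d)
  rw [add_neg_cancel, evalNeg_zero] at h
  exact (neg_eq_of_add_eq_zero_right h.symm).symm

/-- `(d − e)(−c_S) = d(−c_S) − e(−c_S)`. [cite: LaumonNgo2008, COROLLAIRE A.2.4 (App. A.2; Annals pp. 559–572)] -/
theorem evalNeg_sub (c : D →ₗ[R] D) (d e : PolynomialModule R D) :
    evalNeg c (d - e) = evalNeg c d - evalNeg c e := by
  rw [sub_eq_add_neg, evalNeg_add, evalNeg_neg, ← sub_eq_add_neg]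

/-- `(m tⁿ)(−c_S) = (−c_S)ⁿ m`. [cite: LaumonNgo2008, COROLLAIRE A.2.4 (App. A.2; Annals pp. 559–572)] -/
theorem evalNeg_single (c : D →ₗ[R] D) (n : ℕ) (m : D) :
    evalNeg c (single R n m) = ((-c) ^ n : Module.End R D) m := by
  rw [evalNeg, coeff_single, Finsupp.sum_single_index]
  exact map_zero _

/-- `(t + c_S) 0 = 0`. [cite: LaumonNgo2008, COROLLAIRE A.2.4 (App. A.2; Annals pp. 559–572)] -/
theorem mulTAddC_zero (c : D →ₗ[R] D) : mulTAddC c 0 = 0 := by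
  simp [mulTAddC]

/-- `(t + c_S)(−d) = −(t + c_S) d`. [cite: LaumonNgo2008, COROLLAIRE A.2.4 (App. A.2; Annals pp. 559–572)] -/
theorem mulTAddC_neg (c : D →ₗ[R] D) (d : PolynomialModule R D) : mulTAddC c (-d) = -mulTAddC c d := by
  rw [← neg_one_smul R d, mulTAddC_smul, neg_one_smul]

/-- `(t + c_S)(d − e) = (t + c_S) d − (t + c_S) e`. [cite: LaumonNgo2008, COROLLAIRE A.2.4 (App. A.2; Annals pp. 559–572)] -/
theorem mulTAddC_sub (c : D →ₗ[R] D) (d e : PolynomialModule R D) :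
    mulTAddC c (d - e) = mulTAddC c d - mulTAddC c e := by
  rw [sub_eq_add_neg, mulTAddC_add, mulTAddC_neg, ← sub_eq_add_neg]

/-- `(t + c_S)(m tⁿ) = m tⁿ⁺¹ + c_S(m) tⁿ`. [cite: LaumonNgo2008, COROLLAIRE A.2.4 (App. A.2; Annals pp. 559–572)] -/
theorem mulTAddC_single (c : D →ₗ[R] D) (n : ℕ) (m : D) :
    mulTAddC c (single R n m) = single R (n + 1) m + single R n (c m) := by
  rw [mulTAddC, ← Polynomial.monomial_one_one_eq_X, monomial_smul_single, one_smul, Nat.add_comm,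
    PolynomialModule.map_single]

/-- `β ∘ α = 0` on each summand: `((t + c_S) d)(−c_S) = 0`. [cite: LaumonNgo2008, COROLLAIRE A.2.4 (App. A.2; Annals pp. 559–572)] -/
theorem evalNeg_mulTAddC (c : D →ₗ[R] D) (d : PolynomialModule R D) : evalNeg c (mulTAddC c d) = 0 := by
  induction d using PolynomialModule.induction_linear with
  | zero => rw [mulTAddC_zero, evalNeg_zero]
  | add d e hd he => rw [mulTAddC_add, evalNeg_add, hd, he, add_zero]
  | single n m =>
    rw [mulTAddC_single, evalNeg_add, evalNeg_single, evalNeg_single, pow_succ, Module.End.mul_apply,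
      LinearMap.neg_apply, map_neg, neg_add_cancel]

/-- `0 · tⁿ = 0`. [cite: LaumonNgo2008, COROLLAIRE A.2.4 (App. A.2; Annals pp. 559–572)] -/
theorem single_zero' (n : ℕ) : single R n (0 : D) = 0 := by
  rw [← coeff_eq_zero, coeff_single, Finsupp.single_zero]

/-- `(−m) tⁿ = −(m tⁿ)`. [cite: LaumonNgo2008, COROLLAIRE A.2.4 (App. A.2; Annals pp. 559–572)] -/
theorem single_neg' (n : ℕ) (m : D) : single R n (-m) = -single R n m :=
  eq_neg_of_add_eq_zero_left (by rw [← single_add, neg_add_cancel, single_zero'])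

/-- **Division by `t + c_S`** (the exactness at `D[t] ⊕ D[t]`): `d − d(−c_S) ∈ (t + c_S) D[t]`, by `tⁿ⁺¹ m = (t + c_S)(tⁿ m) − tⁿ c_S(m)` and
induction. [cite: LaumonNgo2008, COROLLAIRE A.2.4 (App. A.2; Annals pp. 559–572)] -/
theorem exists_mulTAddC_eq_sub (c : D →ₗ[R] D) (d : PolynomialModule R D) :
    ∃ q : PolynomialModule R D, mulTAddC c q = d - single R 0 (evalNeg c d) := by
  induction d using PolynomialModule.induction_linear with
  | zero => exact ⟨0, by rw [mulTAddC_zero, evalNeg_zero, single_zero', sub_zero]⟩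
  | add d e hd he =>
    obtain ⟨q, hq⟩ := hd
    obtain ⟨q', hq'⟩ := he
    refine ⟨q + q', ?_⟩
    rw [mulTAddC_add, hq, hq', evalNeg_add, single_add]
    abel
  | single n m =>
    induction n generalizing m with
    | zero =>
      refine ⟨0, ?_⟩
      rw [mulTAddC_zero, evalNeg_single, pow_zero, Module.End.one_apply, sub_self]
    | succ n ih =>
      obtain ⟨q', hq'⟩ := ih (c m)
      refine ⟨single R n m - q', ?_⟩
      rw [evalNeg_single] at hq'
      rw [mulTAddC_sub, mulTAddC_single, hq', evalNeg_single, pow_succ, Module.End.mul_apply,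
        LinearMap.neg_apply, map_neg, single_neg']
      abel

/-- The coefficient shift `(t d)_{k+1} = d_k`. [cite: LaumonNgo2008, COROLLAIRE A.2.4 (App. A.2; Annals pp. 559–572)] -/
theorem coeff_X_smul_succ (d : PolynomialModule R D) (k : ℕ) :
    ((Polynomial.X : Polynomial R) • d).coeff (k + 1) = d.coeff k := by
  rw [← Polynomial.monomial_one_one_eq_X, monomial_smul_apply]
  simp

/-- `(c_S d)_k = c_S(d_k)` («`c_S d(t) = Σ_n c_S(d_n) tⁿ`»). [cite: LaumonNgo2008, COROLLAIRE A.2.4 (App. A.2; Annals pp. 559–572)] -/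
theorem coeff_map (c : D →ₗ[R] D) (d : PolynomialModule R D) (k : ℕ) :
    (PolynomialModule.map R c d).coeff k = c (d.coeff k) := by
  induction d using PolynomialModule.induction_linear with
  | zero => rw [map_zero, coeff_zero, Finsupp.zero_apply, map_zero]
  | add d e hd he => rw [map_add, coeff_add, Finsupp.add_apply, hd, he, coeff_add, Finsupp.add_apply, map_add]
  | single n m =>
    rw [PolynomialModule.map_single, coeff_single, coeff_single, Finsupp.single_apply, Finsupp.single_apply]
    split_ifs <;> simp

/-- **`t + c_S` is injective on `D[t]`** (the exactness at `D[t] ⊕ tD[t]`): compare the coefficients of `t^{N+1}`, `N` the top degree.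
[cite: LaumonNgo2008, COROLLAIRE A.2.4 (App. A.2; Annals pp. 559–572)] -/
theorem mulTAddC_injective (c : D →ₗ[R] D) {d : PolynomialModule R D} (h : mulTAddC c d = 0) : d = 0 := by
  by_contra hd
  have hs : d.coeff.support.Nonempty := by
    rw [Finset.nonempty_iff_ne_empty, Ne, Finsupp.support_eq_empty, coeff_eq_zero]
    exact hd
  set N := d.coeff.support.max' hs with hN
  have hNmem : N ∈ d.coeff.support := Finset.max'_mem _ hs
  have hN1 : d.coeff (N + 1) = 0 := by
    by_contra h1
    have := Finset.le_max' _ _ (Finsupp.mem_support_iff.mpr h1)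
    rw [← hN] at this
    omega
  have hcoeff := congrArg (fun e => e.coeff (N + 1)) h
  simp only [mulTAddC, coeff_add, Finsupp.add_apply, coeff_X_smul_succ, coeff_map, hN1, map_zero, add_zero,
    coeff_zero, Finsupp.zero_apply] at hcoeff
  exact (Finsupp.mem_support_iff.mp hNmem) hcoeff

/-- **Discharge of `LaumonNgo2008_A_2_4_exactCore`** — the printed sequence `0 → D[t] ⊕ tD[t] →^α D[t] ⊕ D[t] →^β D → 0` is short exact:
`α` injective (add∕subtract the two components: `2 d₀`, `2 (t + c_S) d₁`, with `2` a unit and `t + c_S` injective, `mulTAddC_injective`);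
`β` surjective (constants); `ker β = im α` (`β ∘ α = 0` by `evalNeg_mulTAddC`; conversely if `e₀(−c_S) = e_∞(−c_S)` then, dividing
`e₀`, `e_∞` by `t + c_S` (`exists_mulTAddC_eq_sub`), `d₀ = ½(e₀ + e_∞)`, `d₁ = ½(q₀ − q_∞)` is a preimage).
[cite: LaumonNgo2008, COROLLAIRE A.2.4, proof (App. A.2; Annals pp. 559–572)] -/
theorem LaumonNgo2008_A_2_4_exactCore_holds : LaumonNgo2008_A_2_4_exactCore := by
  intro R _ D _ _ c h2
  obtain ⟨u, hu⟩ := h2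
  have hu2 : ((u⁻¹ : Rˣ) : R) * 2 = 1 := by rw [← hu, Units.inv_mul]
  have htwo : ∀ x : PolynomialModule R D, ((u⁻¹ : Rˣ) : R) • (x + x) = x := by
    intro x; rw [← two_smul R x, smul_smul, hu2, one_smul]
  refine ⟨?_, ?_, ?_⟩
  · rintro ⟨d₀, d₁⟩ ⟨e₀, e₁⟩ hde
    simp only [alphaMap, Prod.mk.injEq] at hde
    obtain ⟨h₁, h₂⟩ := hde
    have h0 : d₀ = e₀ := by
      have := congrArg₂ (· + ·) h₁ h₂
      simp only [add_add_sub_cancel] at this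
      rw [← htwo d₀, ← htwo e₀, this]
    subst h0
    have h1 : mulTAddC c (d₁ - e₁) = 0 := by
      rw [mulTAddC_sub, sub_eq_zero]; exact add_left_cancel h₁
    rw [Prod.mk.injEq]
    exact ⟨rfl, sub_eq_zero.mp (mulTAddC_injective c h1)⟩
  · intro x
    refine ⟨(single R 0 x, 0), ?_⟩
    rw [betaMap, evalNeg_single, evalNeg_zero, pow_zero, Module.End.one_apply, sub_zero]
  · rintro ⟨e₀, e₁⟩
    constructor
    · intro hβ
      rw [betaMap, sub_eq_zero] at hβ
      obtain ⟨q₀, hq₀⟩ := exists_mulTAddC_eq_sub c e₀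
      obtain ⟨q₁, hq₁⟩ := exists_mulTAddC_eq_sub c e₁
      refine ⟨(((u⁻¹ : Rˣ) : R) • (e₀ + e₁), ((u⁻¹ : Rˣ) : R) • (q₀ - q₁)), ?_⟩
      have hdiff : mulTAddC c (q₀ - q₁) = e₀ - e₁ := by
        rw [mulTAddC_sub, hq₀, hq₁, hβ]; abel
      simp only [alphaMap, mulTAddC_smul, hdiff, ← smul_add, ← smul_sub, Prod.mk.injEq]
      constructor
      · rw [show e₀ + e₁ + (e₀ - e₁) = e₀ + e₀ by abel, htwo]
      · rw [show e₀ + e₁ - (e₀ - e₁) = e₁ + e₁ by abel, htwo]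
    · rintro ⟨⟨d₀, d₁⟩, hd⟩
      simp only [alphaMap, Prod.mk.injEq] at hd
      obtain ⟨rfl, rfl⟩ := hd
      rw [betaMap, evalNeg_add, evalNeg_sub, evalNeg_mulTAddC]
      abel

end DischargesED5

end Literature.NumberTheory.Automorphic.LaumonNgo2008.Appendix
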